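import Mathlib
import Literature.NumberTheory.LFunctions.Zhang2022.RepairBedAssumptionAVacuous
import Literature.NumberTheory.LFunctions.PrimitiveQuadraticCharacterKroneckerEven
import Literature.NumberTheory.LFunctions.KroneckerCharacterPrimitive
import HarnessLib

/-!
# Zhang (2022), rescue bed (D-0124 (3)): Assumption (A) is false for EVERY real primitive Dirichlet
# character of conductor ≤ 10¹² — the composition with the classification of real primitive characters

Topic `Literature/NumberTheory/LFunctions/Zhang2022` (Landau–Siegel audit tree; verdict-neutral).
Y. Zhang, *Discrete mean estimates and the Landau–Siegel zero*, arXiv:2211.02515v1 (2022)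
[Zhang2022LandauSiegel] — **an unrefereed manuscript under adjudication; nothing in this file asserts or
denies its Theorems 1–2, and nothing here is a claim about Landau–Siegel zeros. The programme SEARCHES and
TYPES; no claim about Landau–Siegel zeros, Theorems 1–2 of arXiv:2211.02515 or a repaired Margin232 until a
kernel theorem says so.**

`RepairBedAssumptionAVacuous` refutes `Skeleton.AssumptionA |D| χ_D` for the tree's Kronecker characters
`χ_D = kroneckerChar D` of every fundamental discriminant `|D| ≤ 10¹²`
(`Repair.Bed.Vacuity.not_assumptionA_kroneckerChar_of_natAbs_le_1e12`). The manuscript's (A) is about an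
ARBITRARY real primitive character `χ (mod D)`; the classical dictionary «real primitive characters ↔
fundamental discriminants» (Montgomery–Vaughan Thm. 9.13; in the tree at the level of VALUES:
`PrimitiveQuadratic.apply_prime_eq_legendreSym_of_even` / `…_neg_of_odd`,
`PrimitiveQuadratic.isFundamentalDiscriminant_sign_mul`, `KroneckerCharacter.isKroneckerChar_kroneckerChar`)
closes the gap. This file composes it:

* (private) `eq_of_forall_prime_apply_eq` — two Dirichlet characters of the same modulus that agree at every prime
  agree everywhere (complete multiplicativity + `Nat.recOnMul` + `ZMod.natCast_zmod_val`);
* `changeLevel_kroneckerChar_eq` — a primitive quadratic `χ (mod q)`, `q > 1`, IS the Kronecker character of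
  `D = χ(−1)·q` moved to level `q` (`|D| = q`);
* `not_assumptionA_of_isPrimitive_isQuadratic` — **for every primitive quadratic Dirichlet character `χ`
  of modulus `1 < q ≤ 10¹²`: `¬ AssumptionA q χ`** (`L(1,χ) = L(1,χ_D)` by `LFunction_changeLevel` with an
  empty Euler correction, then the vacuity leaf).

So the rescue BED's honesty rule H2 («(A) is false for every real primitive χ any engine can reach») is a
kernel theorem in exactly the manuscript's generality (an arbitrary real primitive character), for all
conductors up to `10¹²`. Theorems only; no definition; nothing about (A) for large `D`.

## References

* H. L. Montgomery, R. C. Vaughan, *Multiplicative Number Theory I*, CUP 2007, §9.3, Theorem 9.13.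
  [cite: MontgomeryVaughan2007, Theorem 9.13]
* Y. Zhang, arXiv:2211.02515v1 (2022), §2 Assumption (A) p. 4. [cite: Zhang2022LandauSiegel, §2 Assumption (A)]
-/

noncomputable section

open Complex Real DirichletCharacter
open scoped NumberTheorySymbols

namespace Literature.NumberTheory.LFunctions.Zhang2022.Repair.Bed.Vacuity

open Skeleton Literature.NumberTheory.LFunctions.Zhang2022.Repair.Bed
open Literature.NumberTheory.LFunctions.KroneckerCharacter
open Literature.NumberTheory.LFunctions.PrimitiveQuadratic
open Literature.NumberTheory.LFunctions.ChamizoJimenezUrroz2021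

/-! ## Characters are determined by their values at the primes -/

/-- **Two Dirichlet characters of the same modulus that agree at every prime are equal** (both are completely
multiplicative on `ℕ`, every residue class is the class of a natural number). [folklore] -/
private theorem eq_of_forall_prime_apply_eq {q : ℕ} [NeZero q] {χ ψ : DirichletCharacter ℂ q}
    (h : ∀ p : ℕ, p.Prime → χ (p : ZMod q) = ψ (p : ZMod q)) : χ = ψ := by
  have hall : ∀ n : ℕ, χ (n : ZMod q) = ψ (n : ZMod q) := by
    intro n
    induction n using Nat.recOnMul with
    | zero =>
      by_cases hu : IsUnit ((0 : ℕ) : ZMod q)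
      · -- then `q = 1` and `0 = 1`
        have h01 : ((0 : ℕ) : ZMod q) = 1 := by
          rw [Nat.cast_zero] at hu ⊢
          rcases hu with ⟨u, hu⟩
          have hq : q = 1 := by
            by_contra hq
            haveI : Nontrivial (ZMod q) := ZMod.nontrivial_iff.mpr hq
            exact (u.ne_zero hu)
          subst hq
          exact Subsingleton.elim _ _
        rw [h01, map_one, map_one]
      · rw [χ.map_nonunit hu, ψ.map_nonunit hu]
    | one => rw [Nat.cast_one, map_one, map_one]
    | prime p hp => exact h p hp
    | mul a b ha hb => rw [Nat.cast_mul, map_mul, map_mul, ha, hb]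
  refine MulChar.ext fun u => ?_
  have hu : (((u : ZMod q).val : ℕ) : ZMod q) = (u : ZMod q) := ZMod.natCast_zmod_val _
  rw [← hu]
  exact hall _

/-! ## A primitive quadratic character is a Kronecker character -/

/-- The sign `s = χ(−1) ∈ {1, −1}` and the fundamental discriminant `D = s·q` of a primitive quadratic character
`χ (mod q)`, `q > 1`, with `|D| = q` and `|D| ∣ q` (for `changeLevel`).
[cite: MontgomeryVaughan2007, Theorem 9.13] -/
theorem exists_sign_fundamental {q : ℕ} [NeZero q] {χ : DirichletCharacter ℂ q} (hprim : χ.IsPrimitive)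
    (hquad : χ.IsQuadratic) (h1 : 1 < q) :
    ∃ s : ℤ, (s = 1 ∧ χ.Even ∨ s = -1 ∧ χ.Odd) ∧ χ (-1) = (s : ℂ) ∧
      Literature.Barriers.RiemannHypothesis.IsFundamentalDiscriminant (s * q) ∧ (s * (q : ℤ)).natAbs = q := by
  obtain ⟨s, hpar, hs⟩ := exists_sign_eq χ
  have hs1 : s = 1 ∨ s = -1 := by rcases hpar with ⟨h, -⟩ | ⟨h, -⟩ <;> simp [h]
  refine ⟨s, hpar, hs, isFundamentalDiscriminant_sign_mul hprim hquad hs hs1 h1, ?_⟩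
  rcases hs1 with rfl | rfl <;> simp

/-- **A primitive quadratic character `χ (mod q)`, `q > 1`, is the Kronecker character `χ_D`, `D = χ(−1)·q`,
moved to level `q`**: the two characters agree at every prime — at odd primes both are the Legendre symbol
`(D/p)` (`apply_prime_eq_legendreSym_of_even` / `…_neg_of_odd` vs `isKroneckerChar_kroneckerChar`), at `p = 2`
both vanish for even `q` and both are the Jacobi symbol `(2/q)` for odd `q`, at `p ∣ q` both vanish.
[cite: MontgomeryVaughan2007, Theorem 9.13] -/
theorem changeLevel_kroneckerChar_eq {q : ℕ} [NeZero q] {χ : DirichletCharacter ℂ q} (hprim : χ.IsPrimitive)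
    (hquad : χ.IsQuadratic) {s : ℤ} (hpar : s = 1 ∧ χ.Even ∨ s = -1 ∧ χ.Odd)
    (hfd : Literature.Barriers.RiemannHypothesis.IsFundamentalDiscriminant (s * q))
    [NeZero (s * (q : ℤ)).natAbs] (hdvd : (s * (q : ℤ)).natAbs ∣ q) (hDq : (s * (q : ℤ)).natAbs = q) :
    changeLevel hdvd (kroneckerChar (s * q)) = χ := by
  refine eq_of_forall_prime_apply_eq fun p hp => ?_
  haveI : Fact p.Prime := ⟨hp⟩
  by_cases hpq : p ∣ q
  · -- both vanish at a prime dividing the modulus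
    have hnu : ¬ IsUnit ((p : ℕ) : ZMod q) := by rw [ZMod.isUnit_prime_iff_not_dvd hp]; exact fun h => h hpq
    rw [MulChar.map_nonunit _ hnu, MulChar.map_nonunit _ hnu]
  · have hcop : p.Coprime q := (Nat.Prime.coprime_iff_not_dvd hp).mpr hpq
    rw [Literature.NumberTheory.LFunctions.KroneckerCharacter.changeLevel_apply_natCast hdvd _ hcop]
    by_cases hp2 : p = 2
    · -- `p = 2`, so `q` is odd: both values are the Jacobi symbol `(2/q)`
      subst hp2
      have hqodd : Odd q := by
        rcases Nat.even_or_odd q with hev | hod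
        · exact absurd (even_iff_two_dvd.mp hev) hpq
        · exact hod
      have hsq : Squarefree q := squarefree_of_isPrimitive_of_isQuadratic hqodd hprim hquad
      have hD1 : (s * (q : ℤ)) % 4 = 1 := by
        rcases hfd with ⟨h1, -, -⟩ | ⟨h4, -, -⟩
        · exact h1
        · exfalso
          rcases hqodd with ⟨k, hk⟩
          rcases hpar with ⟨rfl, -⟩ | ⟨rfl, -⟩ <;> omega
      rw [kroneckerChar_of_odd hD1, jacobiChar_natCast, apply_natCast_eq_jacobiSym hqodd hsq χ hprim hquad 2,
        hDq]
    · -- odd prime not dividing `q`: both are the Legendre symbol `(D/p)`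
      have hK := (isKroneckerChar_kroneckerChar hfd).2.1 p hp hp2
      rw [hK]
      rcases hpar with ⟨rfl, hev⟩ | ⟨rfl, hod⟩
      · rw [apply_prime_eq_legendreSym_of_even hprim hquad hev p hp2, jacobiSym.legendreSym.to_jacobiSym,
          one_mul]
      · rw [apply_prime_eq_legendreSym_neg_of_odd hprim hquad hod p hp2, jacobiSym.legendreSym.to_jacobiSym,
          neg_one_mul]

/-! ## Assumption (A) for an arbitrary real primitive character -/

/-- **Assumption (A) of arXiv:2211.02515 is false for EVERY primitive quadratic Dirichlet character `χ` of modulus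
`1 < q ≤ 10¹²`**: `χ` is the Kronecker character `χ_D` (`D = χ(−1)q` fundamental, `|D| = q`) moved to level
`q`, `L(1,χ) = L(1,χ_D)` (`DirichletCharacter.LFunction_changeLevel`; the Euler correction over `q`'s primes is
empty because every such prime divides `|D|`), and `¬ AssumptionA |D| χ_D`
(`not_assumptionA_kroneckerChar_of_natAbs_le_1e12`). The manuscript's (A) concerns `D → ∞`; this is the bed's
honesty rule H2 («(A) is vacuous at every modulus an engine reaches»), nothing more.
[cite: Zhang2022LandauSiegel, §2 Assumption (A)] [cite: MontgomeryVaughan2007, Theorem 9.13] -/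
theorem not_assumptionA_of_isPrimitive_isQuadratic {q : ℕ} [NeZero q] {χ : DirichletCharacter ℂ q}
    (hprim : χ.IsPrimitive) (hquad : χ.IsQuadratic) (h1 : 1 < q) (hq : q ≤ 10 ^ 12) :
    ¬ AssumptionA q χ := by
  obtain ⟨s, hpar, hs, hfd, hDq⟩ := exists_sign_fundamental hprim hquad h1
  have h0 : s * (q : ℤ) ≠ 0 := by
    intro h; rw [h] at hDq; simp at hDq; exact (NeZero.ne q) hDq.symm
  haveI hne : NeZero (s * (q : ℤ)).natAbs := ⟨Int.natAbs_ne_zero.mpr h0⟩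
  have hdvd : (s * (q : ℤ)).natAbs ∣ q := by rw [hDq]
  -- (1) χ is the Kronecker character moved to level q
  have hχ := changeLevel_kroneckerChar_eq hprim hquad hpar hfd hdvd hDq
  -- (2) the L-values agree (empty Euler correction)
  have hL : (changeLevel hdvd (kroneckerChar (s * q))).LFunction 1 = (kroneckerChar (s * q)).LFunction 1 := by
    rw [LFunction_changeLevel hdvd _ (Or.inl (kroneckerChar_ne_one hfd))]
    have hprod : ∏ p ∈ q.primeFactors, (1 - kroneckerChar (s * q) (p : ZMod (s * (q : ℤ)).natAbs) *
        (p : ℂ) ^ (-(1 : ℂ))) = 1 := by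
      refine Finset.prod_eq_one fun p hp => ?_
      have hpp : p.Prime := Nat.prime_of_mem_primeFactors hp
      have hpq : p ∣ (s * (q : ℤ)).natAbs := by rw [hDq]; exact Nat.dvd_of_mem_primeFactors hp
      have hnu : ¬ IsUnit ((p : ℕ) : ZMod (s * (q : ℤ)).natAbs) := by
        rw [ZMod.isUnit_prime_iff_not_dvd hpp]; exact fun h => h hpq
      rw [MulChar.map_nonunit _ hnu, zero_mul, sub_zero]
    rw [hprod, mul_one]
  -- (3) the Kronecker character violates (A); transport
  obtain ⟨h0', hκ⟩ := not_assumptionA_kroneckerChar_of_natAbs_le_1e12 hfd (by rw [hDq]; exact hq)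
  intro hA
  apply hκ
  unfold AssumptionA at hA ⊢
  rw [← hL, hχ]
  have hcast : ((s * (q : ℤ)).natAbs : ℝ) = (q : ℝ) := by exact_mod_cast hDq
  rw [hcast]
  exact hA

end Literature.NumberTheory.LFunctions.Zhang2022.Repair.Bed.Vacuity
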